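import Summits.RiemannHypothesis.RiemannHypothesis.Theorems.ScrewLemmaKCoprofileIsometryC1
import HarnessLib

/-!
# K1 without the `L²` proviso: `(h − h₀)²/y² ∈ L¹(0,1)` is automatic for `C¹` data (route ScrewLemmaKCoprofile)

The items `CoprofileIsometry` (stmt-RiemannHypothesis-21612) and the rung leaf `ScrewSmoothSectorKSharp` carry the
proviso `IntegrableOn (fun y => (latticeProfile g y − latticePlateau g)²/y²) (Ioo 0 1)` as a hypothesis.  It is
DISCHARGEABLE (rh-idea-5 desk note 2026-08-27T21:59:39Z (ii); v6 `integrableOn_psi_sq_of_admissible`): with the `C²`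
approximants `p_k` of `ScrewLemmaKCoprofileDensityApprox`, the truncated energies `∫_ε¹ (ψ_{p_0} − ψ_g)² y⁻²` are
bounded uniformly in `ε` (same estimate as in `setIntegral_sq_div_le_of_approx`), so `(ψ_{p_0} − ψ_g)²/y²` is
integrable on `(0,1)` by `AECover.integrable_of_integral_bounded_of_nonneg_ae`, and `ψ_g² ≤ 2ψ_{p_0}² + 2(ψ_{p_0} − ψ_g)²`.

* `integrableOn_sq_div_of_approx` — the abstract integrability lemma;
* `integrableOn_profile_sq_div` — the proviso for every `g ∈ C¹[0,1]` with `g(1) = 0`, `∫₀¹ g = 0`;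
* `profile_isometry_of_C1` — K1 with no proviso; `integrableOn_profile_sq_div_of_admissible` — for admissible `g`.

RH-free real analysis; RH is NOT proved by this file or this route, and nothing here bears on the truth of RH.
-/

noncomputable section

set_option linter.dupNamespace false

namespace Summit.RiemannHypothesis.RiemannHypothesis.Theorems.ScrewLemmaKCoprofile

open MeasureTheory Set Filter Topology
open Summit.RiemannHypothesis.RiemannHypothesis.Theorems.IntegerScrew
open scoped BigOperators

/-- **Integrability from truncated bounds.**  Let `c, b, a_m : (0,1) → ℝ` with `|a_m − b| ≤ η_m → 0` uniformly on
`(0,1)`, `(c − a_m)² y⁻²` integrable on `(0,1)` with `∫₀¹ (c − a_m)² y⁻² ≤ K_m → L`, and `(c − b)² y⁻²` a.e.-strongly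
measurable on `(0,1)`.  Then `(c − b)² y⁻²` is integrable on `(0,1)` (its truncated integrals are `≤ 2L`). [folklore] -/
theorem integrableOn_sq_div_of_approx {a : ℕ → ℝ → ℝ} {b c : ℝ → ℝ} {η K : ℕ → ℝ} {L : ℝ}
    (hη : Tendsto η atTop (𝓝 0))
    (hclose : ∀ m, ∀ y ∈ Ioo (0:ℝ) 1, |a m y - b y| ≤ η m)
    (hint_m : ∀ m, IntegrableOn (fun y => (c y - a m y) ^ 2 / y ^ 2) (Ioo (0:ℝ) 1))
    (hK : ∀ m, ∫ y in Ioo (0:ℝ) 1, (c y - a m y) ^ 2 / y ^ 2 ≤ K m)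
    (hKL : Tendsto K atTop (𝓝 L))
    (hmeas : AEStronglyMeasurable (fun y => (c y - b y) ^ 2 / y ^ 2) (volume.restrict (Ioo (0:ℝ) 1))) :
    IntegrableOn (fun y => (c y - b y) ^ 2 / y ^ 2) (Ioo (0:ℝ) 1) := by
  -- pointwise majorant on (ε,1), for each m
  have hpt : ∀ m, ∀ ε : ℝ, 0 < ε → ∀ y ∈ Ioo ε 1,
      (c y - b y) ^ 2 / y ^ 2 ≤ 2 * ((c y - a m y) ^ 2 / y ^ 2) + 2 * (η m) ^ 2 / ε ^ 2 := by
    intro m ε hε y hy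
    have hsub : Ioo ε 1 ⊆ Ioo (0:ℝ) 1 := Ioo_subset_Ioo hε.le le_rfl
    have hy0 : 0 < y := hε.trans hy.1
    have hab : |a m y - b y| ≤ η m := hclose m y (hsub hy)
    have hsq1 : (a m y - b y) ^ 2 ≤ (η m) ^ 2 := by
      rw [← sq_abs]; exact pow_le_pow_left₀ (abs_nonneg _) hab 2
    have hy2 : ε ^ 2 ≤ y ^ 2 := pow_le_pow_left₀ hε.le hy.1.le 2
    have hη0 : 0 ≤ (η m) ^ 2 := sq_nonneg _
    have h3 : (c y - b y) ^ 2 ≤ 2 * (c y - a m y) ^ 2 + 2 * (a m y - b y) ^ 2 := by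
      nlinarith [sq_nonneg ((c y - a m y) - (a m y - b y))]
    calc (c y - b y) ^ 2 / y ^ 2
        ≤ (2 * (c y - a m y) ^ 2 + 2 * (η m) ^ 2) / y ^ 2 := by gcongr; linarith
      _ = 2 * ((c y - a m y) ^ 2 / y ^ 2) + 2 * (η m) ^ 2 / y ^ 2 := by ring
      _ ≤ 2 * ((c y - a m y) ^ 2 / y ^ 2) + 2 * (η m) ^ 2 / ε ^ 2 := by gcongr
  -- integrability on each (ε,1)
  have hintε : ∀ ε : ℝ, 0 < ε → IntegrableOn (fun y => (c y - b y) ^ 2 / y ^ 2) (Ioo ε 1) := by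
    intro ε hε
    have hsub : Ioo ε 1 ⊆ Ioo (0:ℝ) 1 := Ioo_subset_Ioo hε.le le_rfl
    have hmaj : IntegrableOn (fun y => 2 * ((c y - a 0 y) ^ 2 / y ^ 2) + 2 * (η 0) ^ 2 / ε ^ 2) (Ioo ε 1) :=
      (((hint_m 0).mono_set hsub).const_mul 2).add
        (integrableOn_const (measure_Ioo_lt_top (a := ε) (b := (1:ℝ))).ne)
    refine hmaj.mono' (hmeas.mono_set hsub) ?_
    filter_upwards [ae_restrict_mem measurableSet_Ioo] with y hy
    rw [Real.norm_eq_abs, abs_of_nonneg (by positivity)]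
    exact hpt 0 ε hε y hy
  -- truncated bound ≤ 2L
  have htrunc : ∀ ε : ℝ, 0 < ε → ∫ y in Ioo ε 1, (c y - b y) ^ 2 / y ^ 2 ≤ 2 * L := by
    intro ε hε
    have hsub : Ioo ε 1 ⊆ Ioo (0:ℝ) 1 := Ioo_subset_Ioo hε.le le_rfl
    have hvol : volume.real (Ioo ε 1) ≤ 1 := by
      rw [Real.volume_real_Ioo]
      by_cases h : ε ≤ 1
      · rw [max_eq_left (by linarith)]; linarith
      · rw [max_eq_right (by linarith)]; norm_num
    have hm : ∀ m, ∫ y in Ioo ε 1, (c y - b y) ^ 2 / y ^ 2 ≤ 2 * K m + 2 * (η m) ^ 2 / ε ^ 2 := by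
      intro m
      have h1 : ∫ y in Ioo ε 1, (c y - b y) ^ 2 / y ^ 2
          ≤ ∫ y in Ioo ε 1, (2 * ((c y - a m y) ^ 2 / y ^ 2) + 2 * (η m) ^ 2 / ε ^ 2) :=
        setIntegral_mono_on (hintε ε hε)
          ((((hint_m m).mono_set hsub).const_mul 2).add (integrableOn_const
            (measure_Ioo_lt_top (a := ε) (b := (1:ℝ))).ne)) measurableSet_Ioo (hpt m ε hε)
      have h2 : ∫ y in Ioo ε 1, (2 * ((c y - a m y) ^ 2 / y ^ 2) + 2 * (η m) ^ 2 / ε ^ 2)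
          = 2 * (∫ y in Ioo ε 1, (c y - a m y) ^ 2 / y ^ 2)
            + 2 * (η m) ^ 2 / ε ^ 2 * volume.real (Ioo ε 1) := by
        rw [integral_add (((hint_m m).mono_set hsub).const_mul 2) (integrableOn_const
            (measure_Ioo_lt_top (a := ε) (b := (1:ℝ))).ne), MeasureTheory.integral_const_mul,
          setIntegral_const, smul_eq_mul]
        ring
      have h3 : ∫ y in Ioo ε 1, (c y - a m y) ^ 2 / y ^ 2 ≤ K m :=
        (setIntegral_mono_set (hint_m m) (ae_of_all _ fun y => by positivity)
          (ae_of_all _ hsub)).trans (hK m)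
      have hη2 : 0 ≤ 2 * (η m) ^ 2 / ε ^ 2 := by positivity
      calc ∫ y in Ioo ε 1, (c y - b y) ^ 2 / y ^ 2
          ≤ 2 * (∫ y in Ioo ε 1, (c y - a m y) ^ 2 / y ^ 2)
            + 2 * (η m) ^ 2 / ε ^ 2 * volume.real (Ioo ε 1) := h1.trans_eq h2
        _ ≤ 2 * K m + 2 * (η m) ^ 2 / ε ^ 2 * 1 := by gcongr
        _ = 2 * K m + 2 * (η m) ^ 2 / ε ^ 2 := by ring
    have hlim : Tendsto (fun m => 2 * K m + 2 * (η m) ^ 2 / ε ^ 2) atTop (𝓝 (2 * L + 2 * 0 ^ 2 / ε ^ 2)) :=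
      (hKL.const_mul 2).add ((hη.pow 2).const_mul 2 |>.div_const _)
    rw [zero_pow two_ne_zero, mul_zero, zero_div, add_zero] at hlim
    exact ge_of_tendsto hlim (Eventually.of_forall hm)
  -- AECover of `volume.restrict (Ioo 0 1)` by the sets (1/(n+2), 1)
  have ha : Tendsto (fun n : ℕ => 1 / ((n:ℝ) + 2)) atTop (𝓝 0) := by
    have h := tendsto_one_div_add_atTop_nhds_zero_nat (𝕜 := ℝ)
    have h2 := h.comp (tendsto_add_atTop_nat 1)
    refine h2.congr fun n => ?_
    simp only [Function.comp]
    push_cast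
    ring
  have hcover : AECover (volume.restrict (Ioo (0:ℝ) 1)) atTop fun n : ℕ => Ioo (1 / ((n:ℝ) + 2)) (1:ℝ) :=
    aecover_Ioo_of_Ioo ha tendsto_const_nhds
  have hεn : ∀ n : ℕ, (0:ℝ) < 1 / ((n:ℝ) + 2) := fun n => by positivity
  have hsubn : ∀ n : ℕ, Ioo (1 / ((n:ℝ) + 2)) 1 ⊆ Ioo (0:ℝ) 1 := fun n => Ioo_subset_Ioo (hεn n).le le_rfl
  have hrestr : ∀ n : ℕ, (volume.restrict (Ioo (0:ℝ) 1)).restrict (Ioo (1 / ((n:ℝ) + 2)) 1)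
      = volume.restrict (Ioo (1 / ((n:ℝ) + 2)) 1) := fun n => by
    rw [Measure.restrict_restrict measurableSet_Ioo, inter_eq_self_of_subset_left (hsubn n)]
  have hI : ∀ n : ℕ, IntegrableOn (fun y => (c y - b y) ^ 2 / y ^ 2) (Ioo (1 / ((n:ℝ) + 2)) 1)
      (volume.restrict (Ioo (0:ℝ) 1)) := fun n => by
    rw [IntegrableOn, hrestr n]
    exact hintε _ (hεn n)
  have hB : ∀ᶠ n : ℕ in atTop, ∫ y in Ioo (1 / ((n:ℝ) + 2)) 1, (c y - b y) ^ 2 / y ^ 2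
      ∂(volume.restrict (Ioo (0:ℝ) 1)) ≤ 2 * L := Eventually.of_forall fun n => by
    rw [hrestr n]
    exact htrunc _ (hεn n)
  exact hcover.integrable_of_integral_bounded_of_nonneg_ae (2 * L) hI
    (ae_of_all _ fun y => by positivity) hB

/-- **The `L²` proviso is automatic**: for `g ∈ C¹[0,1]` with `g(1) = 0`, `∫₀¹ g = 0`, the profile deviation has
`(h − h₀)²/y² ∈ L¹(0,1)`.  (Density: `C²` approximant `p_0`, Cauchy estimate from the `C²` isometry, truncated
bounds, `AECover`.) [folklore] -/
theorem integrableOn_profile_sq_div {g : ℝ → ℝ} (hC : ContDiffOn ℝ 1 g (Icc 0 1)) (h1 : g 1 = 0)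
    (hI : ∫ u in (0:ℝ)..1, g u = 0) :
    IntegrableOn (fun y => (latticeProfile g y - latticePlateau g) ^ 2 / y ^ 2) (Ioo (0:ℝ) 1) := by
  -- approximants (as in `profile_isometry`)
  set δ : ℕ → ℝ := fun k => 1 / ((k:ℝ) + 1) with hδ_def
  have hδpos : ∀ k, 0 < δ k := fun k => by positivity
  have hδ0 : Tendsto δ atTop (𝓝 0) := tendsto_one_div_add_atTop_nhds_zero_nat
  choose p hp using fun k : ℕ => exists_smooth_approx hC h1 hI (hδpos k)
  have hpC2 : ∀ k, ContDiff ℝ 2 (p k) := fun k => (hp k).1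
  have hpC2' : ∀ k, ContDiffOn ℝ 2 (p k) (Icc 0 1) := fun k => (hpC2 k).contDiffOn
  have hpC1 : ∀ k, ContDiff ℝ 1 (p k) := fun k => (hpC2 k).of_le (by norm_num)
  have hpC1' : ∀ k, ContDiffOn ℝ 1 (p k) (Icc 0 1) := fun k => (hpC1 k).contDiffOn
  have hpd : ∀ k, Differentiable ℝ (p k) := fun k => (hpC1 k).differentiable one_ne_zero
  have hp1 : ∀ k, p k 1 = 0 := fun k => (hp k).2.1
  have hpI : ∀ k, ∫ u in (0:ℝ)..1, p k u = 0 := fun k => (hp k).2.2.1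
  have hpδ : ∀ k, ∀ u ∈ Icc (0:ℝ) 1, |deriv (p k) u - derivWithin g (Icc 0 1) u| ≤ δ k :=
    fun k => (hp k).2.2.2.1
  have hc0 : (0:ℝ) ≤ 1 / (4 * Real.pi ^ 2) := by positivity
  -- Cauchy estimate between approximants (C² isometry on p_0 − p_m)
  have hdiffC2 : ∀ m, ContDiffOn ℝ 2 (fun u => p 0 u - p m u) (Icc 0 1) := fun m =>
    ((hpC2 0).sub (hpC2 m)).contDiffOn
  have hdiff1 : ∀ m, (fun u => p 0 u - p m u) 1 = 0 := fun m => by simp [hp1]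
  have hdiffI : ∀ m, ∫ u in (0:ℝ)..1, (fun u => p 0 u - p m u) u = 0 := fun m => by
    show ∫ u in (0:ℝ)..1, (p 0 u - p m u) = 0
    rw [intervalIntegral.integral_sub ((hpC1 0).continuous.intervalIntegrable _ _)
      ((hpC1 m).continuous.intervalIntegrable _ _), hpI, hpI, sub_zero]
  have hΦdiff : ∀ m t, latticeCoprofile (fun u => p 0 u - p m u) t
      = latticeCoprofile (p 0) t - latticeCoprofile (p m) t := fun m t => by
    rw [latticeCoprofile_sub]
    unfold latticeCoprofile
    refine Finset.sum_congr rfl fun n _ => ?_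
    have hd : deriv (fun u => p 0 u - p m u) ((n:ℝ) * t) = deriv (p 0) ((n:ℝ) * t) - deriv (p m) ((n:ℝ) * t) :=
      ((hpd 0 _).hasDerivAt.sub (hpd m _).hasDerivAt).deriv
    rw [hd]
  have hδkm : ∀ m, ∀ u ∈ Icc (0:ℝ) 1,
      |deriv (p 0) u - derivWithin (p m) (Icc 0 1) u| ≤ δ 0 + δ m := fun m u hu => by
    rw [derivWithin_Icc_eq_deriv_of_differentiable (hpd m) hu]
    have h1' := hpδ 0 u hu
    have h2' := hpδ m u hu
    calc |deriv (p 0) u - deriv (p m) u|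
        = |(deriv (p 0) u - derivWithin g (Icc 0 1) u) - (deriv (p m) u - derivWithin g (Icc 0 1) u)| := by
          ring_nf
      _ ≤ |deriv (p 0) u - derivWithin g (Icc 0 1) u| + |deriv (p m) u - derivWithin g (Icc 0 1) u| :=
          abs_sub _ _
      _ ≤ δ 0 + δ m := add_le_add h1' h2'
  have hcauchy : ∀ m, ∫ y in Ioo (0:ℝ) 1, ((latticeProfile (p 0) y - latticePlateau (p 0))
      - (latticeProfile (p m) y - latticePlateau (p m))) ^ 2 / y ^ 2
      ≤ (1 / (4 * Real.pi ^ 2)) * (50 * (δ 0 + δ m) ^ 2) := fun m => by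
    have hisoD := ProfileBernoulli.coprofileIsometry_C2 (hdiffC2 m) (hdiff1 m) (hdiffI m)
    simp only [profile_sub_plateau_sub] at hisoD
    have hΦ : ∫ t in Ioo (0:ℝ) 1, (latticeCoprofile (fun u => p 0 u - p m u) t) ^ 2
        ≤ 50 * (δ 0 + δ m) ^ 2 := by
      simp only [hΦdiff]
      exact integral_coprofile_sub_sq_le (by linarith [hδpos 0, hδpos m]) (hδkm m)
    have e : (fun t => (∑ n ∈ Finset.Icc 1 ⌊1 / t⌋₊, deriv (fun u => p 0 u - p m u) (↑n * t) / ↑n) ^ 2)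
        = fun t => (latticeCoprofile (fun u => p 0 u - p m u) t) ^ 2 := rfl
    rw [e] at hisoD
    have h2 : (1 / (4 * Real.pi ^ 2)) * ∫ t in Ioo (0:ℝ) 1, (latticeCoprofile (fun u => p 0 u - p m u) t) ^ 2
        ≤ (1 / (4 * Real.pi ^ 2)) * (50 * (δ 0 + δ m) ^ 2) := mul_le_mul_of_nonneg_left hΦ hc0
    linarith [sq_nonneg (latticePlateau fun u => p 0 u - p m u), hisoD, h2]
  have hintm : ∀ m, IntegrableOn (fun y => ((latticeProfile (p 0) y - latticePlateau (p 0))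
      - (latticeProfile (p m) y - latticePlateau (p m))) ^ 2 / y ^ 2) (Ioo (0:ℝ) 1) := fun m => by
    have h := integrableOn_profile_sq_div_C2 (hdiffC2 m) (hdiff1 m) (hdiffI m)
    refine h.congr_fun (fun y _ => ?_) measurableSet_Ioo
    simp only [profile_sub_plateau_sub]
  have hclose : ∀ m, ∀ y ∈ Ioo (0:ℝ) 1, |(latticeProfile (p m) y - latticePlateau (p m))
      - (latticeProfile g y - latticePlateau g)| ≤ δ m / 2 := fun m y hy =>
    abs_profile_sub_profile_le (hpC1 m) (hp1 m) (hpI m) hC h1 hI (hpδ m) hy.1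
  have hmeas0g : AEStronglyMeasurable (fun y => ((latticeProfile (p 0) y - latticePlateau (p 0))
      - (latticeProfile g y - latticePlateau g)) ^ 2 / y ^ 2) (volume.restrict (Ioo (0:ℝ) 1)) :=
    (((aestronglyMeasurable_profile_sub_plateau (hpC1' 0) (hp1 0) (hpI 0)).sub
      (aestronglyMeasurable_profile_sub_plateau hC h1 hI)).pow 2).mul
      ((measurable_id.pow_const 2).inv.aestronglyMeasurable)
  -- integrability of (ψ_0 − ψ_g)²/y²
  have hint0g : IntegrableOn (fun y => ((latticeProfile (p 0) y - latticePlateau (p 0))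
      - (latticeProfile g y - latticePlateau g)) ^ 2 / y ^ 2) (Ioo (0:ℝ) 1) :=
    integrableOn_sq_div_of_approx (a := fun m y => latticeProfile (p m) y - latticePlateau (p m))
      (b := fun y => latticeProfile g y - latticePlateau g)
      (c := fun y => latticeProfile (p 0) y - latticePlateau (p 0))
      (η := fun m => δ m / 2) (K := fun m => (1 / (4 * Real.pi ^ 2)) * (50 * (δ 0 + δ m) ^ 2))
      (L := (1 / (4 * Real.pi ^ 2)) * (50 * (δ 0 + 0) ^ 2))
      (by simpa using hδ0.div_const 2) hclose hintm hcauchy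
      (((tendsto_const_nhds.add hδ0).pow 2 |>.const_mul 50).const_mul _) hmeas0g
  -- majorant ψ_g² ≤ 2ψ_0² + 2(ψ_0 − ψ_g)²
  have hint0 : IntegrableOn (fun y => (latticeProfile (p 0) y - latticePlateau (p 0)) ^ 2 / y ^ 2) (Ioo (0:ℝ) 1) :=
    integrableOn_profile_sq_div_C2 (hpC2' 0) (hp1 0) (hpI 0)
  have hmeasg : AEStronglyMeasurable (fun y => (latticeProfile g y - latticePlateau g) ^ 2 / y ^ 2)
      (volume.restrict (Ioo (0:ℝ) 1)) :=
    ((aestronglyMeasurable_profile_sub_plateau hC h1 hI).pow 2).mul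
      ((measurable_id.pow_const 2).inv.aestronglyMeasurable)
  refine ((hint0.const_mul 2).add (hint0g.const_mul 2)).mono' hmeasg ?_
  filter_upwards [ae_restrict_mem measurableSet_Ioo] with y hy
  rw [Real.norm_eq_abs, abs_of_nonneg (by positivity)]
  set A := latticeProfile (p 0) y - latticePlateau (p 0) with hA
  set G := latticeProfile g y - latticePlateau g with hG
  have hpt : G ^ 2 ≤ 2 * A ^ 2 + 2 * (A - G) ^ 2 := by nlinarith [sq_nonneg (2 * A - G)]
  calc G ^ 2 / y ^ 2 ≤ (2 * A ^ 2 + 2 * (A - G) ^ 2) / y ^ 2 := by gcongr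
    _ = 2 * (A ^ 2 / y ^ 2) + 2 * ((A - G) ^ 2 / y ^ 2) := by ring

/-- **K1 with no proviso**: for `g ∈ C¹[0,1]` with `g(1) = 0`, `∫₀¹ g = 0`,
`∫₀¹ (h − h₀)² y⁻² dy + h₀² = (4π²)⁻¹ ∫₀¹ Φ_g²`. [folklore] -/
theorem profile_isometry_of_C1 {g : ℝ → ℝ} (hC : ContDiffOn ℝ 1 g (Icc 0 1)) (h1 : g 1 = 0)
    (hI : ∫ u in (0:ℝ)..1, g u = 0) :
    (∫ y in Ioo (0:ℝ) 1, (latticeProfile g y - latticePlateau g) ^ 2 / y ^ 2) + latticePlateau g ^ 2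
      = (1 / (4 * Real.pi ^ 2)) * ∫ t in Ioo (0:ℝ) 1, (latticeCoprofile g t) ^ 2 :=
  profile_isometry hC h1 hI (integrableOn_profile_sq_div hC h1 hI)

/-- For an admissible generator the `L²` proviso of `CoprofileIsometry` / `SmoothSectorKInequality` holds.
[folklore] -/
theorem integrableOn_profile_sq_div_of_admissible {g : ℝ → ℝ} (hg : SmoothSectorAdmissible g) :
    IntegrableOn (fun y => (latticeProfile g y - latticePlateau g) ^ 2 / y ^ 2) (Ioo (0:ℝ) 1) :=
  integrableOn_profile_sq_div hg.1 hg.2.1 hg.2.2.1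

end Summit.RiemannHypothesis.RiemannHypothesis.Theorems.ScrewLemmaKCoprofile

end
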